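import Literature.MathematicalPhysics.QuantumFieldTheory.Balaban1983to89.B13InverseLettersOnCoerciveBall
import Literature.MathematicalPhysics.QuantumFieldTheory.Balaban1983to89.B13GreenStationCoerciveLocated

/-!
# `Balaban1983to89.B13InverseLettersOnCoerciveBallLocated` — T. Bałaban, *Propagators for lattice gauge theories in a background field*, Commun. Math. Phys. **99**
# (1985) 389–434 [Balaban1985BackgroundPropagators], (3.10) p. 392, (3.26)–(3.27) p. 395, Thm 3.3 p. 399, (3.46)–(3.47) p. 398, Thm 3.4 and (3.50) p. 400, (3.84)–(3.86)
# p. 407, Thm 3.10 (3.107)–(3.108) pp. 415–416, Thm 3.11 p. 416; [Balaban1984PropagatorsII] p. 226, Lemma 2.1 (2.61) p. 234; [Balaban1988RG2Cluster] (2.5)–(2.7) pp. 12–13,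
# p. 15: ★★★ THE LANE's MODULES 84 §2 (G's letters on the WHOLE coercivity ball) AND 82 §3 (the thin-radius G-junction fed by print's two statements) LOCATED AT THE
# READINGS OF RECORD — `(M_N(ℂ), matrix units, bondReadingY ∕ fineReadingY, m_F = (d+1)·N², G ≤ U(N))` — and their twins with Δ_a's pencil letters DISCHARGED from the
# R-station's output `hR` (the located local part of this seat's `B13DeltaAPencilLettersLocated` + dag-n10-w2's `D_U R D*_U` sandwich with `C_∂ = C_∂* = 2|c_f|`, `r′ = 1`).

THE DISPLAY.  The lane owner's module 84 (`B13InverseLettersOnCoerciveBall` §2) reads: Δ_a's pencil letters `hA : RawEntryLetters (A′ ↦ toMatrix (Δ_a(e^{iηA′}U₀))) loc R ρ B_Δ`,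
a fibre bound `m_F` of `loc`, the centre's coercivity `m·⟨Ψ,Ψ⟩₁ ≤ ⟨Ψ, Δ_a(U₀)Ψ⟩₁` (or, by module 82, Theorem 3.11's clause `PosDefTr 1 (Δ_a(U₀))` + Theorem 3.3's
(3.46)–(3.47) form bound `⟨Φ, G(U₀)Φ⟩₁ ≤ B⟨Φ,Φ⟩₁`, `m = B⁻¹`), radii `0 ≤ R′ ≤ R` with margin `m′ = m − 2(B_Δ(m_F c₀(1,ρ)^ν))R′∕R > 0` and a Combes–Thomas rate
`0 ≤ κ ≤ ρ∕4`, `8B_Δκ(m_F c₀(1,ρ∕2)^ν) ≤ m′ρ` ⟹ `RawEntryLetters (A′ ↦ toMatrix (G(e^{iηA′}U₀))) loc R′ κ (4∕m′)`.  THIS FILE writes the location numerals in —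
`loc := bondReadingY ∘ fst`, `ν := d+1`, `m_F := (d+1)·N²` (`B13BlockBondReadingNumerals.card_fibre_bondReadingY_matrixUnits`) — (§1), and then DISCHARGES `hA` itself at
`parB := parBY` from the R-station's output `hR` on the site sector at the fine reading (§2: Δ_a's pencil letters at the record as ONE theorem with its constant a NUMBER
`N(η, Rd, ρ, B_R)` in `(d, L, k, N, c_f, b₁)`; then any `B′ ≥ N` stated ONCE as `hBΔ` — the same located inequality as this seat's `B13GreenStationCoerciveLocated` §1).

[folklore] positional applications of cited tree theorems (every theorem ONE application, §2's twins one `have` + `rawEntryLetters_mono` + one application); kernel-checked;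
THEOREMS ONLY (no `def`, no `structure`, no instance, no notation; `open scoped Matrix.Norms.L2Operator` = the record's norm); NOTHING of NODE 00's ∕ pv27's ∕ the lane's ∕
dag-n10-w2's ∕ dag-n10-w5's ∕ dag-n10-w6's files is modified; nothing here is a claim about the Yang–Mills mass gap; no node is discharged; count-neutral.

WHY THIS FILE (cell `pub-ymgap`, HUMAN RULING D-0062 ∕ D-0149, Track A node N10 = [B13]; WIDTH SEAT `pub-ymgap-dag-n10-w4` g6, CLAIM-1 (R455 (A)); lane owner
dag-n10-c g16's RESIDUAL CENSUS v21 «What would move N10 next» item 3: «located editions at the readings of record of 82 §3 ∕ 84 §2 (w4, first refusal)», word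
INBOX l.37877).  WHICH reading ∕ coordinates the N10 term of record uses is NODE 00's ∕ def-T's word — NOT claimed here; LOCATED INSTANCES.

WHAT THIS FILE PROVES (all `theorem`s).
* §1 (Δ_a's pencil letters `hA` DISPLAYED at the bond reading; ANY `N`) ★ `rawEntryLetters_toMatrix_GAY_prodCfg_of_coer_centre_ball_located` (84 §2, first theorem: ANY
  letters `parS parB Gp`, ANY background, flat coercivity `m`) · ★ `rawEntryLetters_toMatrix_GAY_parSymY_prodCfg_ball_of_posDefTr_of_formBound_located` (84 §2, second
  theorem: v4 letters, `G ≤ U(N)`, `G`-valued `U₀`, centre from `hpd` + `hGB`, `m = B⁻¹`) · ★ `rawEntryLetters_toMatrix_GAY_parSymY_prodCfg_thin_of_posDefTr_of_formBound_located`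
  (82 §3: the thin Neumann radius `R∕(4·B_Δ·(4B)·((d+1)N²c₀(1,(κ−ρ′)∕3)^{d+1})² + 1)`, rate `ρ′ < κ`, constant `2(4B)`).
* §2 (`hA` DISCHARGED; `N ≥ 1`, `G ≤ U(N)`, `G`-valued `U₀`, `parB := parBY`) ★★ `rawEntryLetters_toMatrix_deltaAY_parBY_prodCfg_of_pencil_located` — Δ_a's pencil letters AT
  THE RECORD from `hR`: `RawEntryLetters (A′ ↦ toMatrix (Δ_a(e^{iηA′}U₀))) (bondReadingY ∘ fst) Rd ρ N(η,Rd,ρ,B_R)` (dag-n10-w2 g2's `B13OpsYPencilGreen.rawEntryLetters_toMatrix_deltaAY_prodCfg`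
  with `hLoc :=` this seat's `…localDeltaA_prodCfg_located`, `C_∂ = C_∂* = 2|c_f|`, `r′ = 1`, `K₀ = cb = cl = 1`) · ★★★ `rawEntryLetters_toMatrix_GAY_parBY_prodCfg_ball_of_pencil_of_coercive_located`
  (G's letters on the WHOLE coercivity ball `R′ ≤ Rd` from `hR`, `hBΔ`, the flat `hco`, margin and window) · ★★★ `rawEntryLetters_toMatrix_GAY_parBY_prodCfg_ball_of_pencil_of_posDefTr_of_formBound_located`
  (the same at the v4 letters with the centre from `hpd` + `hGB`) · ★★★ `rawEntryLetters_toMatrix_GAY_parBY_prodCfg_of_pencil_of_posDefTr_of_formBound_located` (this seat's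
  `B13GreenStationCoerciveLocated` §1 — the thin-radius station of record — with `(w, Θ, m, hco) := (1, 1, B⁻¹, 82 §2)`: displayed `hpd hB hGB` instead; the lane owner's
  «3-line sibling», INBOX l.37350).
HONEST FRAMING: located instances; finite-lattice constants, NOT optimised, NOT print's `O(1)`; print's multi-scale rate (3.42) is NOT claimed; the analytic inputs — the
R-station's output `hR` (Theorems 3.1 ∕ 3.2 through dag-n10-w2's ∕ dag-n10-w5's stations), Δ_a's coercivity `hco`, resp. Theorem 3.11's clause `hpd` and Theorem 3.3's
(3.46)–(3.47) form bound `hGB` for `G(U₀)` — are DISPLAYED, not proved (N06's ∕ the junction's); the balls are in the CHART around `U₀`, NOT print's class (3.35); nothing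
of Bałaban's asserted; N06 ∕ N10 NOT discharged; K1⁹ stmt-QuantumFields-27364 OPEN, no registered stub proved; counts unmoved (typed 28∕28 · discharged 5∕27); 0 `def`,
0 `sorry`, standard axioms; one finite 𝕋⁴ programme at fixed ε, Bałaban AS PRINTED — R4 closes the conditional finite-𝕋⁴ rung `BalabanLadder.UV` only; the YM mass gap
(Clay) is NOT proved by any of this; nothing continuum ∕ ℝ⁴ ∕ OS.  Filed `--kind proof --supports stmt-QuantumFields-27364`, Literature lane.

References: T. Bałaban, CMP 99 (1985) 389–434 [Balaban1985BackgroundPropagators] (3.10) p.392, (3.25)–(3.27) pp.394–395, (3.46)–(3.47) p.398, Thm 3.3 p.399, Thm 3.4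
and (3.50) p.400, (3.84)–(3.86) p.407, Thm 3.10 (3.107)–(3.108) pp.415–416, Thm 3.11 p.416; CMP 96 (1984) 223–250 [Balaban1984PropagatorsII] (2.19), p.226, (2.54) p.232,
Lemma 2.1 (2.61) p.234; CMP 116 (1988) 1–22 [Balaban1988RG2Cluster] (2.5)–(2.7) pp.12–13, p.15; M. Aizenman, S. Warzel, *Random Operators* (AMS 2015) §10.3 [AizenmanWarzel2015].
-/

noncomputable section

namespace Literature.MathematicalPhysics.QuantumFieldTheory.Balaban1983to89.B13InverseLettersOnCoerciveBallLocated

open Finset Module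
open scoped Matrix Matrix.Norms.L2Operator
open Literature.MathematicalPhysics.QuantumFieldTheory.Balaban1983to89
open Literature.MathematicalPhysics.QuantumFieldTheory.Balaban1983to89.B9Thm37GlueTorus (tdist1)
open Literature.MathematicalPhysics.QuantumFieldTheory.Balaban1983to89.B5TorusCover (UT)
open Literature.MathematicalPhysics.QuantumFieldTheory.Balaban1983to89.B9Thm311ReadingCoords (trIP PosDefTr)
open Literature.MathematicalPhysics.QuantumFieldTheory.Balaban1983to89.B13EntrywiseWalks (RawEntryLetters)
open Literature.MathematicalPhysics.QuantumFieldTheory.Balaban1983to89.B13EntryLetterAlgebra (rawEntryLetters_mono)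
open Literature.MathematicalPhysics.QuantumFieldTheory.Balaban1983to89.B9Eq39Adjoint (prodCfg)
open Literature.MathematicalPhysics.QuantumFieldTheory.Balaban1983to89.B6GlobalChartV1 (PV)
open Literature.MathematicalPhysics.QuantumFieldTheory.Balaban1983to89.B6KLevelCensusIndexV1 (KIdx)
open Literature.MathematicalPhysics.QuantumFieldTheory.Balaban1983to89.Node00
  (SiteY FBondY CfgY SiteParY SiteOpY BondParY RY deltaAY GAY parBY parSymY GpY toKT)
open Literature.MathematicalPhysics.QuantumFieldTheory.Balaban1983to89.B13InverseLettersOnCoerciveBall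
  (rawEntryLetters_toMatrix_GAY_prodCfg_of_coer_centre_ball rawEntryLetters_toMatrix_GAY_parSymY_prodCfg_ball_of_posDefTr_of_formBound)
open Literature.MathematicalPhysics.QuantumFieldTheory.Balaban1983to89.B13CoerciveOfInverseFormBound
  (trIP_deltaAY_parSymY_ge_of_posDefTr_of_GAY_formBound rawEntryLetters_toMatrix_GAY_parSymY_prodCfg_located_of_posDefTr_of_formBound)
open Literature.MathematicalPhysics.QuantumFieldTheory.Balaban1983to89.B13GreenStationCoerciveLocated
  (rawEntryLetters_toMatrix_GAY_parBY_prodCfg_of_pencil_of_coercive_located)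
open Literature.MathematicalPhysics.QuantumFieldTheory.Balaban1983to89.B13OpsYPencilGreen (rawEntryLetters_toMatrix_deltaAY_prodCfg)
open Literature.MathematicalPhysics.QuantumFieldTheory.Balaban1983to89.B13DeltaAPencilLettersLocated (rawEntryLetters_toMatrix_localDeltaA_prodCfg_located)
open Literature.MathematicalPhysics.QuantumFieldTheory.Balaban1983to89.B13GreenStationLocated (sum_abs_gradK_le sum_abs_divK_le)
open Literature.MathematicalPhysics.QuantumFieldTheory.Balaban1983to89.B13MatrixUnitBasisNumerals (norm_stdBasis_repr_le norm_stdBasis_le_one)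
open Literature.MathematicalPhysics.QuantumFieldTheory.Balaban1983to89.B13GreenPrimeSymLettersOfReg335 (norm_unit_le_one_of_mem)
open Literature.MathematicalPhysics.QuantumFieldTheory.Balaban1983to89.B13SiteReadingNumerals (fineReadingY)
open Literature.MathematicalPhysics.QuantumFieldTheory.Balaban1983to89.B13BlockBondReadingNumerals
  (bondReadingY hℓG_bondReadingY hℓD_bondReadingY card_fibre_bondReadingY_matrixUnits)

variable {d ℓ : ℕ} {hd : 1 ≤ d + 1} {hL : Odd (ℓ + 1) ∧ 1 < ℓ + 1} {b₀ b₁ : ℝ}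
variable (i : KIdx d ℓ hd hL b₀ b₁) {N : ℕ} {G : Subgroup (Matrix (Fin N) (Fin N) ℂ)ˣ}
variable {Nf : Fin (d + 1) → ℕ} [∀ μ, NeZero (Nf μ)]

/-! ## §1. Modules 84 §2 and 82 §3 at the bond reading of record: `loc := bondReadingY ∘ fst`, `ν := d+1`, `m_F := (d+1)·N²` (Δ_a's pencil letters displayed) -/

section Displayed

/-- ★ **84 §2 (first theorem) LOCATED — THE G-JUNCTION ON THE WHOLE COERCIVITY BALL AT THE BOND READING OF RECORD** (ANY letters `parS parB Gp`, ANY background `U₀`, ANY `N`):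
Δ_a's pencil letters `hA` at `bondReadingY ∘ fst` (`0 < ρ`), the centre's flat coercivity `m·⟨Ψ,Ψ⟩₁ ≤ ⟨Ψ, Δ_a(U₀)Ψ⟩₁`, radii `0 ≤ R′ ≤ R` with margin
`m′ = m − 2(B_Δ((d+1)N²·c₀(1,ρ)^{d+1}))R′∕R > 0`, a Combes–Thomas rate `0 ≤ κ ≤ ρ∕4` with `8B_Δκ((d+1)N²·c₀(1,ρ∕2)^{d+1}) ≤ m′ρ` ⟹
`RawEntryLetters (A′ ↦ toMatrix (G(e^{iηA′}U₀))) (bondReadingY ∘ fst) R′ κ (4∕m′)`; the fibre bound is `card_fibre_bondReadingY_matrixUnits` (no `hfib` displayed).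
[cite: Balaban1985BackgroundPropagators, (3.26)–(3.27) p.395, Thm 3.4 p.400, (3.84)–(3.86) p.407, Thm 3.10 (3.108) p.416, Thm 3.11 p.416; Balaban1988RG2Cluster, (2.5)–(2.7) pp.12–13, p.15; Balaban1984PropagatorsII, Lemma 2.1 (2.61) p.234; AizenmanWarzel2015, §10.3] -/
theorem rawEntryLetters_toMatrix_GAY_prodCfg_of_coer_centre_ball_located (parS : SiteParY (Matrix (Fin N) (Fin N) ℂ) i)
    (parB : BondParY (Matrix (Fin N) (Fin N) ℂ) i) (Gp : SiteOpY (Matrix (Fin N) (Fin N) ℂ) i) (U₀ : CfgY (Matrix (Fin N) (Fin N) ℂ) i)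
    (hNf : ∀ μ, (toKT i).NB μ = Nf μ) (η : ℝ) {R R' ρ BΔ m : ℝ}
    (hA : RawEntryLetters (fun a : Fin (d + 1) → Site (PV d ℓ i.m i.K hd hL) 0 → Matrix (Fin N) (Fin N) ℂ =>
      LinearMap.toMatrix
        ((Pi.basis fun _ : FBondY i => Matrix.stdBasis ℂ (Fin N) (Fin N)).reindex (Equiv.sigmaEquivProd (FBondY i) (Fin N × Fin N)))
        ((Pi.basis fun _ : FBondY i => Matrix.stdBasis ℂ (Fin N) (Fin N)).reindex (Equiv.sigmaEquivProd (FBondY i) (Fin N × Fin N)))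
        (deltaAY i parS parB Gp (prodCfg U₀ η a)))
      (fun p : FBondY i × (Fin N × Fin N) => bondReadingY i hNf p.1) R ρ BΔ)
    (hρ : 0 < ρ)
    (hco : ∀ Ψ : FBondY i → Matrix (Fin N) (Fin N) ℂ, m * trIP (fun _ => (1 : ℝ)) Ψ Ψ ≤ trIP (fun _ => (1 : ℝ)) Ψ (deltaAY i parS parB Gp U₀ Ψ))
    (hR' : 0 ≤ R') (hR'R : R' ≤ R) (hmarg : 0 < m - 2 * (BΔ * ((((d + 1) * (N * N) : ℕ) : ℝ) * B6.c0 1 ρ ^ (d + 1))) * R' / R)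
    {κ : ℝ} (hκ : 0 ≤ κ) (hκ4 : κ ≤ ρ / 4)
    (hκm : 8 * BΔ * κ * ((((d + 1) * (N * N) : ℕ) : ℝ) * B6.c0 1 (ρ / 2) ^ (d + 1)) ≤
      (m - 2 * (BΔ * ((((d + 1) * (N * N) : ℕ) : ℝ) * B6.c0 1 ρ ^ (d + 1))) * R' / R) * ρ) :
    RawEntryLetters (fun a : Fin (d + 1) → Site (PV d ℓ i.m i.K hd hL) 0 → Matrix (Fin N) (Fin N) ℂ =>
        LinearMap.toMatrix
          ((Pi.basis fun _ : FBondY i => Matrix.stdBasis ℂ (Fin N) (Fin N)).reindex (Equiv.sigmaEquivProd (FBondY i) (Fin N × Fin N)))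
          ((Pi.basis fun _ : FBondY i => Matrix.stdBasis ℂ (Fin N) (Fin N)).reindex (Equiv.sigmaEquivProd (FBondY i) (Fin N × Fin N)))
          (GAY i parS parB Gp (prodCfg U₀ η a)))
      (fun p : FBondY i × (Fin N × Fin N) => bondReadingY i hNf p.1) R'
      κ (4 / (m - 2 * (BΔ * ((((d + 1) * (N * N) : ℕ) : ℝ) * B6.c0 1 ρ ^ (d + 1))) * R' / R)) :=
  rawEntryLetters_toMatrix_GAY_prodCfg_of_coer_centre_ball i parS parB Gp U₀ η hA hρ (card_fibre_bondReadingY_matrixUnits i hNf) hco hR' hR'R hmarg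
    hκ hκ4 hκm

/-- ★ **84 §2 (second theorem) LOCATED — THE BALL G-JUNCTION WITH THE CENTRE FROM PRINT's TWO STATEMENTS, AT THE BOND READING OF RECORD** (v4 letters
`parSymY ∕ parBY ∕ G′ = GpY parSymY`, `G ≤ U(N)`, `G`-valued `U₀`): Theorem 3.11's clause `PosDefTr 1 (Δ_a(U₀))` + Theorem 3.3's (3.46)–(3.47) form bound
`⟨Φ, G(U₀)Φ⟩₁ ≤ B⟨Φ,Φ⟩₁` (`0 < B`; module 82: `m = B⁻¹`), Δ_a's pencil letters at `bondReadingY ∘ fst`, the margin `B⁻¹ − 2(B_Δ((d+1)N²c₀(1,ρ)^{d+1}))R′∕R > 0` and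
the window ⟹ `RawEntryLetters (A′ ↦ toMatrix (G(e^{iηA′}U₀))) (bondReadingY ∘ fst) R′ κ (4∕m′)`.
[cite: Balaban1985BackgroundPropagators, (3.26)–(3.27) p.395, (3.46)–(3.47) p.398, Thm 3.3 p.399, Thm 3.4 p.400, Thm 3.10 (3.108) p.416, Thm 3.11 p.416; Balaban1984PropagatorsII, p.226; Balaban1988RG2Cluster, p.15; AizenmanWarzel2015, §10.3] -/
theorem rawEntryLetters_toMatrix_GAY_parSymY_prodCfg_ball_of_posDefTr_of_formBound_located
    (hG : G ≤ B7Prop2Explicit.unitaryUnits (Matrix (Fin N) (Fin N) ℂ))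
    {U₀ : CfgY (Matrix (Fin N) (Fin N) ℂ) i} (hU : ∀ μ x, U₀ μ x ∈ G) (hNf : ∀ μ, (toKT i).NB μ = Nf μ) (η : ℝ) {R R' ρ BΔ : ℝ}
    (hA : RawEntryLetters (fun a : Fin (d + 1) → Site (PV d ℓ i.m i.K hd hL) 0 → Matrix (Fin N) (Fin N) ℂ =>
      LinearMap.toMatrix
        ((Pi.basis fun _ : FBondY i => Matrix.stdBasis ℂ (Fin N) (Fin N)).reindex (Equiv.sigmaEquivProd (FBondY i) (Fin N × Fin N)))
        ((Pi.basis fun _ : FBondY i => Matrix.stdBasis ℂ (Fin N) (Fin N)).reindex (Equiv.sigmaEquivProd (FBondY i) (Fin N × Fin N)))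
        (deltaAY i (parSymY i) (parBY i) (GpY i (parSymY i)) (prodCfg U₀ η a)))
      (fun p : FBondY i × (Fin N × Fin N) => bondReadingY i hNf p.1) R ρ BΔ)
    (hρ : 0 < ρ)
    -- print's two statements at the centre: Theorem 3.11's clause (row 17) and Theorem 3.3's (3.46)–(3.47) for `G`
    (hpd : PosDefTr (fun _ => (1 : ℝ)) (deltaAY i (parSymY i) (parBY i) (GpY i (parSymY i)) U₀))
    {B : ℝ} (hB : 0 < B)
    (hGB : ∀ Φ : FBondY i → Matrix (Fin N) (Fin N) ℂ,
      trIP (fun _ => (1 : ℝ)) Φ (GAY i (parSymY i) (parBY i) (GpY i (parSymY i)) U₀ Φ) ≤ B * trIP (fun _ => (1 : ℝ)) Φ Φ)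
    (hR' : 0 ≤ R') (hR'R : R' ≤ R) (hmarg : 0 < B⁻¹ - 2 * (BΔ * ((((d + 1) * (N * N) : ℕ) : ℝ) * B6.c0 1 ρ ^ (d + 1))) * R' / R)
    {κ : ℝ} (hκ : 0 ≤ κ) (hκ4 : κ ≤ ρ / 4)
    (hκm : 8 * BΔ * κ * ((((d + 1) * (N * N) : ℕ) : ℝ) * B6.c0 1 (ρ / 2) ^ (d + 1)) ≤
      (B⁻¹ - 2 * (BΔ * ((((d + 1) * (N * N) : ℕ) : ℝ) * B6.c0 1 ρ ^ (d + 1))) * R' / R) * ρ) :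
    RawEntryLetters (fun a : Fin (d + 1) → Site (PV d ℓ i.m i.K hd hL) 0 → Matrix (Fin N) (Fin N) ℂ =>
        LinearMap.toMatrix
          ((Pi.basis fun _ : FBondY i => Matrix.stdBasis ℂ (Fin N) (Fin N)).reindex (Equiv.sigmaEquivProd (FBondY i) (Fin N × Fin N)))
          ((Pi.basis fun _ : FBondY i => Matrix.stdBasis ℂ (Fin N) (Fin N)).reindex (Equiv.sigmaEquivProd (FBondY i) (Fin N × Fin N)))
          (GAY i (parSymY i) (parBY i) (GpY i (parSymY i)) (prodCfg U₀ η a)))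
      (fun p : FBondY i × (Fin N × Fin N) => bondReadingY i hNf p.1) R'
      κ (4 / (B⁻¹ - 2 * (BΔ * ((((d + 1) * (N * N) : ℕ) : ℝ) * B6.c0 1 ρ ^ (d + 1))) * R' / R)) :=
  rawEntryLetters_toMatrix_GAY_parSymY_prodCfg_ball_of_posDefTr_of_formBound i hG hU η hA hρ (card_fibre_bondReadingY_matrixUnits i hNf) hpd hB hGB
    hR' hR'R hmarg hκ hκ4 hκm

/-- ★ **82 §3 LOCATED — THE THIN-RADIUS G-JUNCTION FED BY PRINT's TWO STATEMENTS, AT THE BOND READING OF RECORD** (v4 letters, `G ≤ U(N)`, `G`-valued `U₀`):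
Δ_a's pencil letters at `bondReadingY ∘ fst` (`0 < R`, `0 < ρ`), `hpd`, `hGB` (`0 < B`), the Combes–Thomas window `0 ≤ κ ≤ ρ∕4`,
`8B_Δκ((d+1)N²c₀(1,ρ∕2)^{d+1}) ≤ B⁻¹ρ`, `0 ≤ ρ′ < κ` ⟹ `RawEntryLetters (A′ ↦ toMatrix (G(e^{iηA′}U₀))) (bondReadingY ∘ fst)
(R∕(4·B_Δ·(4B)·((d+1)N²c₀(1,(κ−ρ′)∕3)^{d+1})² + 1)) ρ′ (2(4B))`.
[cite: Balaban1985BackgroundPropagators, (3.26)–(3.27) p.395, (3.46)–(3.47) p.398, Thm 3.3 p.399, Thm 3.4 p.400, (3.84)–(3.86) p.407, Thm 3.10 (3.108) p.416, Thm 3.11 p.416; Balaban1984PropagatorsII, p.226, Lemma 2.1 (2.61) p.234; Balaban1988RG2Cluster, (2.5)–(2.7) pp.12–13; AizenmanWarzel2015, §10.3] -/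
theorem rawEntryLetters_toMatrix_GAY_parSymY_prodCfg_thin_of_posDefTr_of_formBound_located
    (hG : G ≤ B7Prop2Explicit.unitaryUnits (Matrix (Fin N) (Fin N) ℂ))
    {U₀ : CfgY (Matrix (Fin N) (Fin N) ℂ) i} (hU : ∀ μ x, U₀ μ x ∈ G) (hNf : ∀ μ, (toKT i).NB μ = Nf μ) (η : ℝ) {R ρ BΔ : ℝ}
    (hA : RawEntryLetters (fun a : Fin (d + 1) → Site (PV d ℓ i.m i.K hd hL) 0 → Matrix (Fin N) (Fin N) ℂ =>
      LinearMap.toMatrix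
        ((Pi.basis fun _ : FBondY i => Matrix.stdBasis ℂ (Fin N) (Fin N)).reindex (Equiv.sigmaEquivProd (FBondY i) (Fin N × Fin N)))
        ((Pi.basis fun _ : FBondY i => Matrix.stdBasis ℂ (Fin N) (Fin N)).reindex (Equiv.sigmaEquivProd (FBondY i) (Fin N × Fin N)))
        (deltaAY i (parSymY i) (parBY i) (GpY i (parSymY i)) (prodCfg U₀ η a)))
      (fun p : FBondY i × (Fin N × Fin N) => bondReadingY i hNf p.1) R ρ BΔ)
    (hR : 0 < R) (hρ : 0 < ρ)
    (hpd : PosDefTr (fun _ => (1 : ℝ)) (deltaAY i (parSymY i) (parBY i) (GpY i (parSymY i)) U₀))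
    {B : ℝ} (hB : 0 < B)
    (hGB : ∀ Φ : FBondY i → Matrix (Fin N) (Fin N) ℂ,
      trIP (fun _ => (1 : ℝ)) Φ (GAY i (parSymY i) (parBY i) (GpY i (parSymY i)) U₀ Φ) ≤ B * trIP (fun _ => (1 : ℝ)) Φ Φ)
    {κ : ℝ} (hκ : 0 ≤ κ) (hκ4 : κ ≤ ρ / 4)
    (hκm : 8 * BΔ * κ * ((((d + 1) * (N * N) : ℕ) : ℝ) * B6.c0 1 (ρ / 2) ^ (d + 1)) ≤ B⁻¹ * ρ)
    {ρ' : ℝ} (hρ'0 : 0 ≤ ρ') (hρ' : ρ' < κ) :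
    RawEntryLetters (fun a : Fin (d + 1) → Site (PV d ℓ i.m i.K hd hL) 0 → Matrix (Fin N) (Fin N) ℂ =>
        LinearMap.toMatrix
          ((Pi.basis fun _ : FBondY i => Matrix.stdBasis ℂ (Fin N) (Fin N)).reindex (Equiv.sigmaEquivProd (FBondY i) (Fin N × Fin N)))
          ((Pi.basis fun _ : FBondY i => Matrix.stdBasis ℂ (Fin N) (Fin N)).reindex (Equiv.sigmaEquivProd (FBondY i) (Fin N × Fin N)))
          (GAY i (parSymY i) (parBY i) (GpY i (parSymY i)) (prodCfg U₀ η a)))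
      (fun p : FBondY i × (Fin N × Fin N) => bondReadingY i hNf p.1)
      (R / (4 * (BΔ * (4 * B) * ((((d + 1) * (N * N) : ℕ) : ℝ) * B6.c0 1 ((κ - ρ') / 3) ^ (d + 1)) *
        ((((d + 1) * (N * N) : ℕ) : ℝ) * B6.c0 1 ((κ - ρ') / 3) ^ (d + 1))) + 1)) ρ' (2 * (4 * B)) :=
  rawEntryLetters_toMatrix_GAY_parSymY_prodCfg_located_of_posDefTr_of_formBound i hG hU η hA hR hρ hpd hB hGB (card_fibre_bondReadingY_matrixUnits i hNf)
    hκ hκ4 hκm hρ'0 hρ'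

end Displayed

/-! ## §2. Δ_a's pencil letters DISCHARGED from the R-station's output `hR` (`parB := parBY`, `G ≤ U(N)`, `G`-valued `U₀`, `N ≥ 1`) -/

section Discharged

variable [NeZero N]
variable (parS : SiteParY (Matrix (Fin N) (Fin N) ℂ) i) (Gp : SiteOpY (Matrix (Fin N) (Fin N) ℂ) i)

/-- ★★ **Δ_a's PENCIL LETTERS AT THE RECORD FROM THE R-STATION's OUTPUT — `RawEntryLetters (A′ ↦ toMatrix (Δ_a(e^{iηA′}U₀))) (bondReadingY ∘ fst) Rd ρ N(η,Rd,ρ,B_R)`.**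
dag-n10-w2 g2's `B13OpsYPencilGreen.rawEntryLetters_toMatrix_deltaAY_prodCfg` (`Δ_a = (Δ + Q*aQ) + D_U R D*_U` along pv27's pencil) at `parB := parBY`, matrix-unit
coordinates (`cb = cl = 1`), `K₀ = 1` (`G ≤ U(N)`), sites read by `fineReadingY`, bonds by `bondReadingY` (`r′ = 1`), `C_∂ = C_∂* = 2|c_f|`, with the local part
`hLoc :=` this seat's `B13DeltaAPencilLettersLocated.rawEntryLetters_toMatrix_localDeltaA_prodCfg_located` (76 §4 located: `c₁ = 4|c_f|`, `c₂ = 4(d+1)|c_f|`, `N_b = 4(d+1)`,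
`D = (d+2)(L^k−1)`, `c_Q = 1`, `c_{Q*} = 2`, `c_a = |b₁|c_f²(L^k)^{d+1}`, `s = 2(d+2)(L^k−1)`).  DISPLAYED ONLY: `hG`, `hU₀`, `hNf`, `η`, `0 ≤ Rd`, `0 ≤ ρ` and the
R-station's output `hR` (radius `Rd`, rate `ρ`, constant `B_R`, at the fine reading).  The constant is the NUMBER that this seat's `B13GreenStationCoerciveLocated` §1
dominates once by `B′` (`hBΔ`).
[cite: Balaban1985BackgroundPropagators, (3.10) p.392, (3.25)–(3.26) pp.394–395, Thm 3.4 and (3.50) p.400, (3.84) p.407, Thm 3.10 (3.107)–(3.108) p.416; Balaban1984PropagatorsII, (2.54) p.232; Balaban1988RG2Cluster, (2.5)–(2.7) pp.12–13, p.15] -/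
theorem rawEntryLetters_toMatrix_deltaAY_parBY_prodCfg_of_pencil_located
    (hG : G ≤ B7Prop2Explicit.unitaryUnits (Matrix (Fin N) (Fin N) ℂ))
    {U₀ : CfgY (Matrix (Fin N) (Fin N) ℂ) i} (hU₀ : ∀ μ x, U₀ μ x ∈ G)
    (hNf : ∀ μ, (toKT i).NB μ = Nf μ) (η : ℝ) {Rd : ℝ} (hRd : 0 ≤ Rd) {ρ BR : ℝ} (hρ : 0 ≤ ρ)
    (hR : RawEntryLetters (fun a : Fin (d + 1) → Site (PV d ℓ i.m i.K hd hL) 0 → Matrix (Fin N) (Fin N) ℂ =>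
      LinearMap.toMatrix
        ((Pi.basis fun _ : SiteY i => Matrix.stdBasis ℂ (Fin N) (Fin N)).reindex (Equiv.sigmaEquivProd (SiteY i) (Fin N × Fin N)))
        ((Pi.basis fun _ : SiteY i => Matrix.stdBasis ℂ (Fin N) (Fin N)).reindex (Equiv.sigmaEquivProd (SiteY i) (Fin N × Fin N)))
        (RY i parS Gp (prodCfg U₀ η a)))
      (fun q : SiteY i × (Fin N × Fin N) => fineReadingY i hNf q.1) Rd ρ BR) :
    RawEntryLetters (fun a : Fin (d + 1) → Site (PV d ℓ i.m i.K hd hL) 0 → Matrix (Fin N) (Fin N) ℂ =>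
        LinearMap.toMatrix
          ((Pi.basis fun _ : FBondY i => Matrix.stdBasis ℂ (Fin N) (Fin N)).reindex (Equiv.sigmaEquivProd (FBondY i) (Fin N × Fin N)))
          ((Pi.basis fun _ : FBondY i => Matrix.stdBasis ℂ (Fin N) (Fin N)).reindex (Equiv.sigmaEquivProd (FBondY i) (Fin N × Fin N)))
          (deltaAY i parS (parBY i) Gp (prodCfg U₀ η a)))
      (fun p : FBondY i × (Fin N × Fin N) => bondReadingY i hNf p.1) Rd ρ
      (1 * (((4 * ((d : ℝ) + 1) * |i.cf|) * (1 * Real.exp (|η| * Rd) *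
          ((1 * Real.exp (|η| * Rd)) ^ 4 * ((4 * |i.cf|) * (1 * Real.exp (|η| * Rd) * 1 * (1 * Real.exp (|η| * Rd))))) *
          (1 * Real.exp (|η| * Rd))) +
        1 / 2 * ((4 * ((d : ℝ) + 1)) * (1 * Real.exp (|η| * Rd) *
          (2 * (i.cf ^ 2 * (1 * Real.exp (|η| * Rd)) ^ 4) * (8 * (1 * Real.exp (|η| * Rd) * 1 * (1 * Real.exp (|η| * Rd))))) *
          (1 * Real.exp (|η| * Rd))))) +
      2 * ((1 * Real.exp (|η| * Rd)) ^ ((d + 2) * ((ℓ + 1) ^ i.k - 1)) *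
        ((|b₁| * i.cf ^ 2 * ((((ℓ + 1 : ℕ) : ℝ)) ^ i.k) ^ (d + 1)) * (1 * ((1 * Real.exp (|η| * Rd)) ^ ((d + 2) * ((ℓ + 1) ^ i.k - 1)) * 1 * (1 * Real.exp (|η| * Rd)) ^ ((d + 2) * ((ℓ + 1) ^ i.k - 1))))) * (1 * Real.exp (|η| * Rd)) ^ ((d + 2) * ((ℓ + 1) ^ i.k - 1)))) * Real.exp (ρ * (2 * (((d : ℝ) + 2) * ((((ℓ + 1) ^ i.k : ℕ) : ℝ) - 1)))) +
      (2 * |i.cf|) * (Fintype.card (Fin N × Fin N) : ℝ) * (1 * (1 * Real.exp (|η| * Rd) * 1 * (1 * Real.exp (|η| * Rd)))) *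
        ((2 * |i.cf|) * (Fintype.card (Fin N × Fin N) : ℝ) * (1 * (1 * Real.exp (|η| * Rd) * 1 * (1 * Real.exp (|η| * Rd))))) * BR * Real.exp (2 * ρ * 1)) :=
  rawEntryLetters_toMatrix_deltaAY_prodCfg i (Matrix.stdBasis ℂ (Fin N) (Fin N)) U₀ η parS (parBY i) Gp (norm_unit_le_one_of_mem i hG hU₀).1
    (norm_unit_le_one_of_mem i hG hU₀).2 le_rfl hRd (by positivity) (sum_abs_gradK_le i) (by positivity) (sum_abs_divK_le i) norm_stdBasis_repr_le
    zero_le_one norm_stdBasis_le_one zero_le_one (fineReadingY i hNf) (bondReadingY i hNf) (hℓG_bondReadingY i hNf) (hℓD_bondReadingY i hNf) hρ hR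
    (rawEntryLetters_toMatrix_localDeltaA_prodCfg_located i hG hU₀ hNf η hRd hρ)

/-- ★★★ **G's LETTERS ON THE WHOLE COERCIVITY BALL FROM THE R-STATION's OUTPUT — dag-n10-w2's station of record re-run through the lane's module 84** (ANY `parS Gp`,
`parB := parBY`, `G ≤ U(N)`, `G`-valued `U₀`): the R-station's output `hR` at the fine reading (radius `Rd`, rate `ρ > 0`, constant `B_R`), ONE dominating constant
`B′` for the assembled Δ_a letters (`hBΔ`, its left side the NUMBER of `rawEntryLetters_toMatrix_deltaAY_parBY_prodCfg_of_pencil_located`), the centre's flat coercivity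
`m·⟨Ψ,Ψ⟩₁ ≤ ⟨Ψ, Δ_a(U₀)Ψ⟩₁`, radii `0 ≤ R′ ≤ Rd` with margin `m′ = m − 2(B′((d+1)N²c₀(1,ρ)^{d+1}))R′∕Rd > 0`, a Combes–Thomas rate `0 ≤ κ ≤ ρ∕4` with
`8B′κ((d+1)N²c₀(1,ρ∕2)^{d+1}) ≤ m′ρ` ⟹ `RawEntryLetters (A′ ↦ toMatrix (G(e^{iηA′}U₀))) (bondReadingY ∘ fst) R′ κ (4∕m′)` — on the radius `R′` itself (versus the
thin Neumann radius of `B13GreenStationCoerciveLocated` §1).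
[cite: Balaban1985BackgroundPropagators, (3.10) p.392, (3.26)–(3.27) p.395, Thm 3.3 p.399, Thm 3.4 and (3.50) p.400, (3.84)–(3.86) p.407, Thm 3.10 (3.107)–(3.108) pp.415–416, Thm 3.11 p.416; Balaban1984PropagatorsII, (2.19) and p.226, Lemma 2.1 (2.61) p.234; Balaban1988RG2Cluster, (2.5)–(2.7) pp.12–13, p.15; AizenmanWarzel2015, §10.3] -/
theorem rawEntryLetters_toMatrix_GAY_parBY_prodCfg_ball_of_pencil_of_coercive_located
    (hG : G ≤ B7Prop2Explicit.unitaryUnits (Matrix (Fin N) (Fin N) ℂ))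
    {U₀ : CfgY (Matrix (Fin N) (Fin N) ℂ) i} (hU₀ : ∀ μ x, U₀ μ x ∈ G)
    (hNf : ∀ μ, (toKT i).NB μ = Nf μ) (η : ℝ) {Rd : ℝ} (hRd : 0 ≤ Rd) {ρ BR : ℝ} (hρ : 0 < ρ)
    (hR : RawEntryLetters (fun a : Fin (d + 1) → Site (PV d ℓ i.m i.K hd hL) 0 → Matrix (Fin N) (Fin N) ℂ =>
      LinearMap.toMatrix
        ((Pi.basis fun _ : SiteY i => Matrix.stdBasis ℂ (Fin N) (Fin N)).reindex (Equiv.sigmaEquivProd (SiteY i) (Fin N × Fin N)))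
        ((Pi.basis fun _ : SiteY i => Matrix.stdBasis ℂ (Fin N) (Fin N)).reindex (Equiv.sigmaEquivProd (SiteY i) (Fin N × Fin N)))
        (RY i parS Gp (prodCfg U₀ η a)))
      (fun q : SiteY i × (Fin N × Fin N) => fineReadingY i hNf q.1) Rd ρ BR)
    {B' : ℝ}
    (hBΔ : 1 * (((4 * ((d : ℝ) + 1) * |i.cf|) * ((1 * Real.exp (|η| * Rd)) * ((1 * Real.exp (|η| * Rd)) ^ 4 * ((4 * |i.cf|) * ((1 * Real.exp (|η| * Rd)) * 1 * (1 * Real.exp (|η| * Rd))))) * (1 * Real.exp (|η| * Rd))) + 1 / 2 * ((4 * ((d : ℝ) + 1)) * ((1 * Real.exp (|η| * Rd)) * (2 * (i.cf ^ 2 * (1 * Real.exp (|η| * Rd)) ^ 4) * (8 * ((1 * Real.exp (|η| * Rd)) * 1 * (1 * Real.exp (|η| * Rd))))) * (1 * Real.exp (|η| * Rd))))) + 2 * ((1 * Real.exp (|η| * Rd)) ^ ((d + 2) * ((ℓ + 1) ^ i.k - 1)) * ((|b₁| * i.cf ^ 2 * ((((ℓ + 1 : ℕ) : ℝ)) ^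 i.k) ^ (d + 1)) * (1 * ((1 * Real.exp (|η| * Rd)) ^ ((d + 2) * ((ℓ + 1) ^ i.k - 1)) * 1 * (1 * Real.exp (|η| * Rd)) ^ ((d + 2) * ((ℓ + 1) ^ i.k - 1))))) * (1 * Real.exp (|η| * Rd)) ^ ((d + 2) * ((ℓ + 1) ^ i.k - 1)))) * Real.exp (ρ * (2 * (((d : ℝ) + 2) * ((((ℓ + 1) ^ i.k : ℕ) : ℝ) - 1)))) +
          (2 * |i.cf|) * (Fintype.card (Fin N × Fin N) : ℝ) * (1 * ((1 * Real.exp (|η| * Rd)) * 1 * (1 * Real.exp (|η| * Rd)))) * ((2 * |i.cf|) * (Fintype.card (Fin N × Fin N) : ℝ) * (1 * ((1 * Real.exp (|η| * Rd)) * 1 * (1 * Real.exp (|η| * Rd))))) * BR * Real.exp (2 * ρ * 1) ≤ B')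
    {m : ℝ}
    (hco : ∀ Ψ : FBondY i → Matrix (Fin N) (Fin N) ℂ, m * trIP (fun _ => (1 : ℝ)) Ψ Ψ ≤ trIP (fun _ => (1 : ℝ)) Ψ (deltaAY i parS (parBY i) Gp U₀ Ψ))
    {R' : ℝ} (hR' : 0 ≤ R') (hR'R : R' ≤ Rd) (hmarg : 0 < m - 2 * (B' * ((((d + 1) * (N * N) : ℕ) : ℝ) * B6.c0 1 ρ ^ (d + 1))) * R' / Rd)
    {κ : ℝ} (hκ : 0 ≤ κ) (hκ4 : κ ≤ ρ / 4)
    (hκm : 8 * B' * κ * ((((d + 1) * (N * N) : ℕ) : ℝ) * B6.c0 1 (ρ / 2) ^ (d + 1)) ≤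
      (m - 2 * (B' * ((((d + 1) * (N * N) : ℕ) : ℝ) * B6.c0 1 ρ ^ (d + 1))) * R' / Rd) * ρ) :
    RawEntryLetters (fun a : Fin (d + 1) → Site (PV d ℓ i.m i.K hd hL) 0 → Matrix (Fin N) (Fin N) ℂ =>
        LinearMap.toMatrix
          ((Pi.basis fun _ : FBondY i => Matrix.stdBasis ℂ (Fin N) (Fin N)).reindex (Equiv.sigmaEquivProd (FBondY i) (Fin N × Fin N)))
          ((Pi.basis fun _ : FBondY i => Matrix.stdBasis ℂ (Fin N) (Fin N)).reindex (Equiv.sigmaEquivProd (FBondY i) (Fin N × Fin N)))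
          (GAY i parS (parBY i) Gp (prodCfg U₀ η a)))
      (fun p : FBondY i × (Fin N × Fin N) => bondReadingY i hNf p.1) R'
      κ (4 / (m - 2 * (B' * ((((d + 1) * (N * N) : ℕ) : ℝ) * B6.c0 1 ρ ^ (d + 1))) * R' / Rd)) := by
  -- Δ_a along the pencil at the record from `hR`, then dominate its constant by `B'`
  have hA := rawEntryLetters_toMatrix_deltaAY_parBY_prodCfg_of_pencil_located i parS Gp hG hU₀ hNf η hRd hρ.le hR
  exact rawEntryLetters_toMatrix_GAY_prodCfg_of_coer_centre_ball_located i parS (parBY i) Gp U₀ hNf η (rawEntryLetters_mono hA le_rfl le_rfl hBΔ) hρ hco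
    hR' hR'R hmarg hκ hκ4 hκm

/-- ★★★ **G's LETTERS ON THE WHOLE COERCIVITY BALL FROM THE R-STATION's OUTPUT, CENTRE FROM PRINT's TWO STATEMENTS** (v4 letters `parSymY ∕ parBY ∕ G′ = GpY parSymY`,
`G ≤ U(N)`, `G`-valued `U₀`): as `rawEntryLetters_toMatrix_GAY_parBY_prodCfg_ball_of_pencil_of_coercive_located` with the centre's coercivity SUPPLIED by module 82 §2 from
Theorem 3.11's clause `PosDefTr 1 (Δ_a(U₀))` (row 17) and Theorem 3.3's (3.46)–(3.47) form bound `⟨Φ, G(U₀)Φ⟩₁ ≤ B⟨Φ,Φ⟩₁` (`0 < B`), `m = B⁻¹`: displayed `hR`, `hBΔ`,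
`hpd`, `hB`, `hGB`, radii ∕ margin ∕ window with `B⁻¹`; conclusion `RawEntryLetters (A′ ↦ toMatrix (G(e^{iηA′}U₀))) (bondReadingY ∘ fst) R′ κ (4∕(B⁻¹ − 2(B′c_V)R′∕Rd))`.
[cite: Balaban1985BackgroundPropagators, (3.10) p.392, (3.26)–(3.27) p.395, (3.46)–(3.47) p.398, Thm 3.3 p.399, Thm 3.4 and (3.50) p.400, (3.84)–(3.86) p.407, Thm 3.10 (3.107)–(3.108) pp.415–416, Thm 3.11 p.416; Balaban1984PropagatorsII, p.226, Lemma 2.1 (2.61) p.234; Balaban1988RG2Cluster, (2.5)–(2.7) pp.12–13, p.15; AizenmanWarzel2015, §10.3] -/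
theorem rawEntryLetters_toMatrix_GAY_parBY_prodCfg_ball_of_pencil_of_posDefTr_of_formBound_located
    (hG : G ≤ B7Prop2Explicit.unitaryUnits (Matrix (Fin N) (Fin N) ℂ))
    {U₀ : CfgY (Matrix (Fin N) (Fin N) ℂ) i} (hU₀ : ∀ μ x, U₀ μ x ∈ G)
    (hNf : ∀ μ, (toKT i).NB μ = Nf μ) (η : ℝ) {Rd : ℝ} (hRd : 0 ≤ Rd) {ρ BR : ℝ} (hρ : 0 < ρ)
    (hR : RawEntryLetters (fun a : Fin (d + 1) → Site (PV d ℓ i.m i.K hd hL) 0 → Matrix (Fin N) (Fin N) ℂ =>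
      LinearMap.toMatrix
        ((Pi.basis fun _ : SiteY i => Matrix.stdBasis ℂ (Fin N) (Fin N)).reindex (Equiv.sigmaEquivProd (SiteY i) (Fin N × Fin N)))
        ((Pi.basis fun _ : SiteY i => Matrix.stdBasis ℂ (Fin N) (Fin N)).reindex (Equiv.sigmaEquivProd (SiteY i) (Fin N × Fin N)))
        (RY i (parSymY i) (GpY i (parSymY i)) (prodCfg U₀ η a)))
      (fun q : SiteY i × (Fin N × Fin N) => fineReadingY i hNf q.1) Rd ρ BR)
    {B' : ℝ}
    (hBΔ : 1 * (((4 * ((d : ℝ) + 1) * |i.cf|) * ((1 * Real.exp (|η| * Rd)) * ((1 * Real.exp (|η| * Rd)) ^ 4 * ((4 * |i.cf|) * ((1 * Real.exp (|η| * Rd)) * 1 * (1 * Real.exp (|η| * Rd))))) * (1 * Real.exp (|η| * Rd))) + 1 / 2 * ((4 * ((d : ℝ) + 1)) * ((1 * Real.exp (|η| * Rd)) * (2 * (i.cf ^ 2 * (1 * Real.exp (|η| * Rd)) ^ 4) * (8 * ((1 * Real.exp (|η| * Rd)) * 1 * (1 * Real.exp (|η| * Rd))))) * (1 * Real.exp (|η|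 * Rd))))) + 2 * ((1 * Real.exp (|η| * Rd)) ^ ((d + 2) * ((ℓ + 1) ^ i.k - 1)) * ((|b₁| * i.cf ^ 2 * ((((ℓ + 1 : ℕ) : ℝ)) ^ i.k) ^ (d + 1)) * (1 * ((1 * Real.exp (|η| * Rd)) ^ ((d + 2) * ((ℓ + 1) ^ i.k - 1)) * 1 * (1 * Real.exp (|η| * Rd)) ^ ((d + 2) * ((ℓ + 1) ^ i.k - 1))))) * (1 * Real.exp (|η| * Rd)) ^ ((d + 2) * ((ℓ + 1) ^ i.k - 1)))) * Real.exp (ρ * (2 * (((d : ℝ) + 2) * ((((ℓ + 1) ^ i.k : ℕ) : ℝ) - 1)))) +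
          (2 * |i.cf|) * (Fintype.card (Fin N × Fin N) : ℝ) * (1 * ((1 * Real.exp (|η| * Rd)) * 1 * (1 * Real.exp (|η| * Rd)))) * ((2 * |i.cf|) * (Fintype.card (Fin N × Fin N) : ℝ) * (1 * ((1 * Real.exp (|η| * Rd)) * 1 * (1 * Real.exp (|η| * Rd))))) * BR * Real.exp (2 * ρ * 1) ≤ B')
    -- print's two statements at the centre: Theorem 3.11's clause (row 17) and Theorem 3.3's (3.46)–(3.47) for `G`
    (hpd : PosDefTr (fun _ => (1 : ℝ)) (deltaAY i (parSymY i) (parBY i) (GpY i (parSymY i)) U₀))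
    {B : ℝ} (hB : 0 < B)
    (hGB : ∀ Φ : FBondY i → Matrix (Fin N) (Fin N) ℂ,
      trIP (fun _ => (1 : ℝ)) Φ (GAY i (parSymY i) (parBY i) (GpY i (parSymY i)) U₀ Φ) ≤ B * trIP (fun _ => (1 : ℝ)) Φ Φ)
    {R' : ℝ} (hR' : 0 ≤ R') (hR'R : R' ≤ Rd) (hmarg : 0 < B⁻¹ - 2 * (B' * ((((d + 1) * (N * N) : ℕ) : ℝ) * B6.c0 1 ρ ^ (d + 1))) * R' / Rd)
    {κ : ℝ} (hκ : 0 ≤ κ) (hκ4 : κ ≤ ρ / 4)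
    (hκm : 8 * B' * κ * ((((d + 1) * (N * N) : ℕ) : ℝ) * B6.c0 1 (ρ / 2) ^ (d + 1)) ≤
      (B⁻¹ - 2 * (B' * ((((d + 1) * (N * N) : ℕ) : ℝ) * B6.c0 1 ρ ^ (d + 1))) * R' / Rd) * ρ) :
    RawEntryLetters (fun a : Fin (d + 1) → Site (PV d ℓ i.m i.K hd hL) 0 → Matrix (Fin N) (Fin N) ℂ =>
        LinearMap.toMatrix
          ((Pi.basis fun _ : FBondY i => Matrix.stdBasis ℂ (Fin N) (Fin N)).reindex (Equiv.sigmaEquivProd (FBondY i) (Fin N × Fin N)))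
          ((Pi.basis fun _ : FBondY i => Matrix.stdBasis ℂ (Fin N) (Fin N)).reindex (Equiv.sigmaEquivProd (FBondY i) (Fin N × Fin N)))
          (GAY i (parSymY i) (parBY i) (GpY i (parSymY i)) (prodCfg U₀ η a)))
      (fun p : FBondY i × (Fin N × Fin N) => bondReadingY i hNf p.1) R'
      κ (4 / (B⁻¹ - 2 * (B' * ((((d + 1) * (N * N) : ℕ) : ℝ) * B6.c0 1 ρ ^ (d + 1))) * R' / Rd)) :=
  rawEntryLetters_toMatrix_GAY_parBY_prodCfg_ball_of_pencil_of_coercive_located i (parSymY i) (GpY i (parSymY i)) hG hU₀ hNf η hRd hρ hR hBΔ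
    (trIP_deltaAY_parSymY_ge_of_posDefTr_of_GAY_formBound i hG hU₀ hpd hB hGB) hR' hR'R hmarg hκ hκ4 hκm

/-- ★★★ **THE THIN-RADIUS STATION OF RECORD WITH `(w, Θ, m, hco) := (1, 1, B⁻¹, module 82 §2)`** — this seat's `B13GreenStationCoerciveLocated` §1
(`rawEntryLetters_toMatrix_GAY_parBY_prodCfg_of_pencil_of_coercive_located`) at the v4 letters with its displayed form bound SUPPLIED from Theorem 3.11's clause
`PosDefTr 1 (Δ_a(U₀))` and Theorem 3.3's (3.46)–(3.47) form bound `⟨Φ, G(U₀)Φ⟩₁ ≤ B⟨Φ,Φ⟩₁` (the lane owner's «3-line sibling»): displayed `hG`, `hU₀`, `hNf`, `η`,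
`0 < Rd`, `0 < ρ`, `hR`, `hBΔ`, `hpd`, `0 < B`, `hGB`, the window `0 ≤ κ ≤ ρ∕4`, `8B′κ((d+1)N²c₀(1,ρ∕2)^{d+1}) ≤ B⁻¹ρ`, `0 ≤ ρ′ < κ`; conclusion
`RawEntryLetters (A′ ↦ toMatrix (G(e^{iηA′}U₀))) (bondReadingY ∘ fst) (Rd∕(4·B′·(4B)·((d+1)N²c₀(1,(κ−ρ′)∕3)^{d+1})² + 1)) ρ′ (2(4B))`.
[cite: Balaban1985BackgroundPropagators, (3.10) p.392, (3.26)–(3.27) p.395, (3.46)–(3.47) p.398, Thm 3.3 p.399, Thm 3.4 and (3.50) p.400, (3.84)–(3.86) p.407, Thm 3.10 (3.107)–(3.108) pp.415–416, Thm 3.11 p.416; Balaban1984PropagatorsII, (2.19) and p.226, Lemma 2.1 (2.61) p.234; Balaban1988RG2Cluster, (2.5)–(2.7) pp.12–13, p.15; AizenmanWarzel2015, §10.3] -/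
theorem rawEntryLetters_toMatrix_GAY_parBY_prodCfg_of_pencil_of_posDefTr_of_formBound_located
    (hG : G ≤ B7Prop2Explicit.unitaryUnits (Matrix (Fin N) (Fin N) ℂ))
    {U₀ : CfgY (Matrix (Fin N) (Fin N) ℂ) i} (hU₀ : ∀ μ x, U₀ μ x ∈ G)
    (hNf : ∀ μ, (toKT i).NB μ = Nf μ) (η : ℝ) {Rd : ℝ} (hRpos : 0 < Rd) {ρ BR : ℝ} (hρ : 0 < ρ)
    (hR : RawEntryLetters (fun a : Fin (d + 1) → Site (PV d ℓ i.m i.K hd hL) 0 → Matrix (Fin N) (Fin N) ℂ =>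
      LinearMap.toMatrix
        ((Pi.basis fun _ : SiteY i => Matrix.stdBasis ℂ (Fin N) (Fin N)).reindex (Equiv.sigmaEquivProd (SiteY i) (Fin N × Fin N)))
        ((Pi.basis fun _ : SiteY i => Matrix.stdBasis ℂ (Fin N) (Fin N)).reindex (Equiv.sigmaEquivProd (SiteY i) (Fin N × Fin N)))
        (RY i (parSymY i) (GpY i (parSymY i)) (prodCfg U₀ η a)))
      (fun q : SiteY i × (Fin N × Fin N) => fineReadingY i hNf q.1) Rd ρ BR)
    {B' : ℝ}
    (hBΔ : 1 * (((4 * ((d : ℝ) + 1) * |i.cf|) * ((1 * Real.exp (|η| * Rd)) * ((1 * Real.exp (|η| * Rd)) ^ 4 * ((4 * |i.cf|) * ((1 * Real.exp (|η| * Rd)) * 1 * (1 * Real.exp (|η| * Rd))))) * (1 * Real.exp (|η| * Rd))) + 1 / 2 * ((4 * ((d : ℝ) + 1)) * ((1 * Real.exp (|η| * Rd)) * (2 * (i.cf ^ 2 * (1 * Real.exp (|η| * Rd)) ^ 4) * (8 * ((1 * Real.exp (|η| * Rd)) * 1 * (1 * Real.exp (|η| * Rd))))) * (1 * Real.exp (|η|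 * Rd))))) + 2 * ((1 * Real.exp (|η| * Rd)) ^ ((d + 2) * ((ℓ + 1) ^ i.k - 1)) * ((|b₁| * i.cf ^ 2 * ((((ℓ + 1 : ℕ) : ℝ)) ^ i.k) ^ (d + 1)) * (1 * ((1 * Real.exp (|η| * Rd)) ^ ((d + 2) * ((ℓ + 1) ^ i.k - 1)) * 1 * (1 * Real.exp (|η| * Rd)) ^ ((d + 2) * ((ℓ + 1) ^ i.k - 1))))) * (1 * Real.exp (|η| * Rd)) ^ ((d + 2) * ((ℓ + 1) ^ i.k - 1)))) * Real.exp (ρ * (2 * (((d : ℝ) + 2) * ((((ℓ + 1) ^ i.k : ℕ) : ℝ) - 1)))) +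
          (2 * |i.cf|) * (Fintype.card (Fin N × Fin N) : ℝ) * (1 * ((1 * Real.exp (|η| * Rd)) * 1 * (1 * Real.exp (|η| * Rd)))) * ((2 * |i.cf|) * (Fintype.card (Fin N × Fin N) : ℝ) * (1 * ((1 * Real.exp (|η| * Rd)) * 1 * (1 * Real.exp (|η| * Rd))))) * BR * Real.exp (2 * ρ * 1) ≤ B')
    -- print's two statements at the centre: Theorem 3.11's clause (row 17) and Theorem 3.3's (3.46)–(3.47) for `G`
    (hpd : PosDefTr (fun _ => (1 : ℝ)) (deltaAY i (parSymY i) (parBY i) (GpY i (parSymY i)) U₀))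
    {B : ℝ} (hB : 0 < B)
    (hGB : ∀ Φ : FBondY i → Matrix (Fin N) (Fin N) ℂ,
      trIP (fun _ => (1 : ℝ)) Φ (GAY i (parSymY i) (parBY i) (GpY i (parSymY i)) U₀ Φ) ≤ B * trIP (fun _ => (1 : ℝ)) Φ Φ)
    {κ : ℝ} (hκ : 0 ≤ κ) (hκ4 : κ ≤ ρ / 4)
    (hκm : 8 * B' * κ * ((((d + 1) * (N * N) : ℕ) : ℝ) * B6.c0 1 (ρ / 2) ^ (d + 1)) ≤ B⁻¹ * ρ)
    {ρ' : ℝ} (hρ'0 : 0 ≤ ρ') (hρ' : ρ' < κ) :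
    RawEntryLetters (fun a : Fin (d + 1) → Site (PV d ℓ i.m i.K hd hL) 0 → Matrix (Fin N) (Fin N) ℂ =>
        LinearMap.toMatrix
          ((Pi.basis fun _ : FBondY i => Matrix.stdBasis ℂ (Fin N) (Fin N)).reindex (Equiv.sigmaEquivProd (FBondY i) (Fin N × Fin N)))
          ((Pi.basis fun _ : FBondY i => Matrix.stdBasis ℂ (Fin N) (Fin N)).reindex (Equiv.sigmaEquivProd (FBondY i) (Fin N × Fin N)))
          (GAY i (parSymY i) (parBY i) (GpY i (parSymY i)) (prodCfg U₀ η a)))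
      (fun p : FBondY i × (Fin N × Fin N) => bondReadingY i hNf p.1)
      (Rd / (4 * (B' * (4 * B) * ((((d + 1) * (N * N) : ℕ) : ℝ) * B6.c0 1 ((κ - ρ') / 3) ^ (d + 1)) *
        ((((d + 1) * (N * N) : ℕ) : ℝ) * B6.c0 1 ((κ - ρ') / 3) ^ (d + 1))) + 1)) ρ' (2 * (4 * B)) := by
  have h := rawEntryLetters_toMatrix_GAY_parBY_prodCfg_of_pencil_of_coercive_located i (parSymY i) (GpY i (parSymY i)) hG hU₀ hNf η hRpos hρ hR hBΔ
    (fun _ => (1 : ℝ)) (fun _ => one_pos) zero_le_one (fun _ _ => by rw [one_mul]) (inv_pos.mpr hB)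
    (trIP_deltaAY_parSymY_ge_of_posDefTr_of_GAY_formBound i hG hU₀ hpd hB hGB) hκ hκ4 (by simpa only [one_mul] using hκm) hρ'0 hρ'
  simpa only [div_inv_eq_mul, one_mul] using h

end Discharged

end Literature.MathematicalPhysics.QuantumFieldTheory.Balaban1983to89.B13InverseLettersOnCoerciveBallLocated

end
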